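import Summits.CriticalPhenomena.CardyFormulaZ2.Theorems.CardyIKTransportCornerLineDescentCrudeContinuity
import Summits.CriticalPhenomena.CardyFormulaZ2.Theorems.CardyFlipRussoCoveringLegWideBridge
import Summits.CriticalPhenomena.CardyFormulaZ2.Theorems.UnionJackBeffaraMixedInterpolationStubCrossMonoInner
import Literature.Probability.Percolation.QuadCrossingContinuityEventsDischarge
import HarnessLib

/-!
# The bracket gap at `q = 0` — stub `stub_bracketGapZero` (T3) of line `registered`

Crux stmt-CriticalPhenomena-4559 `UnionJackBeffara.MixedInterpolation`, line `registered` (skeleton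
`Cruxes/MixedInterpolation/Lines/birth.lean`, v6), stub T3 of the tame-to-general transfer: for a conformal rectangle `R`
with square model `F`, at a suitable chart scale `s`, the `P_{1/2,0}` (Kesten's bond-`ℤ²`) crude crossing probabilities
of ANY outer bracket `R'` and ANY inner bracket `R''` differ eventually by at most `e`.  Proof: `(κ, ρ)` from the tree's
`Freeze.CrudeCrossingContinuity R (e/3)` (PROVED for every `R` from the discharged Schramm–Smirnov Lemma 5.1,
`stub_CrudeCrossingContinuity_of_SS`); `s := min (1/4) (η/8)` with `η` the uniform-continuity modulus of `F` on
`closedBall 0 4` at `min (ρ/2) κ`; the BOND events satisfy `embDomainCrossing(R') ⊆ Freeze.upperCrossing R ρ`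
(`outer_subset_upperCrossing`: clauses (U1), (U2)) and `Freeze.lowerCrossing R κ ρ ⊆ embDomainCrossing(R'')`
(`lowerCrossing_subset_inner`: run extraction `Freeze.exists_run` with the sides "drawn in `collar₀`/`collar₂`, outside
`Ω` and outside `Ω''`"; clauses (N1), (L), (N3), (N4)), whence `bondProb R' − bondProb R'' ≤ e/3` eventually in the
bond mesh `d`; Kesten's covering in this frame (`wide_tendsto_sub`) adds `e/3` twice and `tendsto_comp_const_mul_iff`
passes to the Union-Jack mesh `√2 d`; the bound (N4) `R'' ⊆ F(|im| < 1+2s)` is essential (skeleton v6, history).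
References: Schramm–Smirnov, Ann. Probab. 39 (2011) §5, Lemma 5.1; Kesten (1982) §3.4; Beffara (2008) §5.1.
(buildfix 2026-08-20: comment-only re-land to re-enqueue the module build after its blocking imports were repaired; no declaration changed.)
-/
noncomputable section

namespace Summit.CriticalPhenomena.CardyFormulaZ2.Cruxes.MixedInterpolation.Registered

open Set Filter Topology MeasureTheory Metric
open Literature.Probability.LatticeModels Literature.Probability.Percolation
open Literature.Probability.RandomPlanarGeometry
open Literature.Barriers.CriticalPhenomena (MixedSite mixedParam)
open Summit.CriticalPhenomena.CardyFormulaZ2.Theorems.CornerLineDescent.SymmetricSeed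
open Summit.CriticalPhenomena.CardyFormulaZ2.Cruxes.CoveringLeg.FiveArmNull (wide_tendsto_sub bondProb tendsto_comp_const_mul_iff)

/-! ### Metric and chart bookkeeping -/

/-- Distance to a chart point from bounds on the coordinate offsets (`‖z‖ ≤ |re z| + |im z|`). [folklore] -/
theorem dist_mk_le {q : ℂ} {a b u v : ℝ} (ha : |q.re - a| ≤ u) (hb : |q.im - b| ≤ v) : dist q ⟨a, b⟩ ≤ u + v := by
  rw [Complex.dist_eq]; exact (Complex.norm_le_abs_re_add_abs_im _).trans (by simpa using add_le_add ha hb)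

/-- A chart point with `|re|, |im| ≤ 2` has norm at most `4`. [folklore] -/
theorem norm_le_four {q : ℂ} (h1 : |q.re| ≤ 2) (h2 : |q.im| ≤ 2) : ‖q‖ ≤ 4 := by
  linarith [Complex.norm_le_abs_re_add_abs_im q]

/-- Clamping a real within `s` of `[-1, 1]` to `[-1, 1]` moves it by at most `s`. [folklore] -/
theorem clamp_spec {t s : ℝ} (hs : 0 ≤ s) (h1 : -1 - s ≤ t) (h2 : t ≤ 1 + s) :
    |t - max (-1) (min 1 t)| ≤ s ∧ |max (-1) (min 1 t)| ≤ 1 := by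
  simp only [max_def, min_def]
  split_ifs <;> (rw [abs_le, abs_le]; exact ⟨⟨by linarith, by linarith⟩, by linarith, by linarith⟩)

/-- Uniform continuity of a homeomorphism of `ℂ` on a closed ball, in `ε`/`η` form. [folklore] -/
theorem exists_modulus_closedBall (G : ℂ ≃ₜ ℂ) (r : ℝ) {ε : ℝ} (hε : 0 < ε) :
    ∃ η : ℝ, 0 < η ∧ ∀ q q' : ℂ, ‖q‖ ≤ r → ‖q'‖ ≤ r → dist q q' < η → dist (G q) (G q') < ε := by
  obtain ⟨η, hη, h⟩ := Metric.uniformContinuousOn_iff.1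
    ((isCompact_closedBall (0 : ℂ) r).uniformContinuousOn_of_continuous G.continuous.continuousOn) ε hε
  exact ⟨η, hη, fun q q' hq hq' => h q (mem_closedBall_zero_iff.2 hq) q' (mem_closedBall_zero_iff.2 hq')⟩

/-- The closed chart square goes into the closed carrier. [folklore] -/
theorem chart_mem_closure {R : ConformalRectangle} {F : ℂ ≃ₜ ℂ} (hF : IsSquareModel R F) {q : ℂ} (h1 : |q.re| ≤ 1)
    (h2 : |q.im| ≤ 1) : F q ∈ closure R.carrier :=
  hF.image_Icc ▸ mem_image_of_mem _ (Complex.mem_reProdIm.2 ⟨mem_Icc.2 (abs_le.1 h1), mem_Icc.2 (abs_le.1 h2)⟩)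

/-- The horizontal sides `im = ∓1` of the chart square go onto `R.arc 0` / `R.arc 2`. [folklore] -/
theorem chart_mem_arc_im {R : ConformalRectangle} {F : ℂ ≃ₜ ℂ} (hF : IsSquareModel R F) {q : ℂ} (h1 : |q.re| ≤ 1) :
    (q.im = -1 → F q ∈ R.arc 0) ∧ (q.im = 1 → F q ∈ R.arc 2) :=
  ⟨fun h => hF.image_arc 0 ▸ mem_image_of_mem _ (SquareModel.mem_arc_zero.2 ⟨h, mem_Icc.2 (abs_le.1 h1)⟩),
    fun h => hF.image_arc 2 ▸ mem_image_of_mem _ (SquareModel.mem_arc_two.2 ⟨h, mem_Icc.2 (abs_le.1 h1)⟩)⟩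

/-- The vertical sides `re = ±1` of the chart square go into `R.arc 1 ∪ R.arc 3`. [folklore] -/
theorem chart_mem_arc_re {R : ConformalRectangle} {F : ℂ ≃ₜ ℂ} (hF : IsSquareModel R F) {q : ℂ} (h1 : |q.re| = 1)
    (h2 : |q.im| ≤ 1) : F q ∈ R.arc 1 ∪ R.arc 3 := by
  rcases (abs_eq zero_le_one).1 h1 with h | h
  · exact Or.inl (hF.image_arc 1 ▸ mem_image_of_mem _ (SquareModel.mem_arc_one.2 ⟨h, mem_Icc.2 (abs_le.1 h2)⟩))
  · exact Or.inr (hF.image_arc 3 ▸ mem_image_of_mem _ (SquareModel.mem_arc_three.2 ⟨h, mem_Icc.2 (abs_le.1 h2)⟩))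

/-- Points of `R.arc 1 ∪ R.arc 3` lie outside the enlarged domain `Ω ∪ collar₀ ∪ collar₂` (`κ > 0`): they are on the
frontier of the open carrier and at distance `0` from the "other arcs" of both sides `0` and `2`. [folklore] -/
theorem not_mem_enlarge_of_mem_arc {R : ConformalRectangle} {κ : ℝ} (hκ : 0 < κ) {a : ℂ}
    (ha : a ∈ R.arc 1 ∪ R.arc 3) : a ∉ Freeze.enlarge R κ := by
  have key : ∀ {j : Fin 4}, j ≠ 0 → j ≠ 2 → a ∈ R.arc j → a ∉ Freeze.enlarge R κ := fun hj0 hj2 hj => by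
    have h0 := (Freeze.infDist_otherArcs_le (R := R) hj0 a).trans (infDist_zero_of_mem hj).le
    have h2 := (Freeze.infDist_otherArcs_le (R := R) hj2 a).trans (infDist_zero_of_mem hj).le
    rintro ((h | h) | h)
    · exact (R.arc_subset_frontier _ hj).2 (by rwa [R.isOpen.interior_eq])
    · linarith [h.2]
    · linarith [h.2]
  exact ha.elim (key (by decide) (by decide)) (key (by decide) (by decide))

/-- The enlarged domain lies within `κ` of the closed carrier, hence in a ball. [folklore] -/
theorem enlarge_subset_closedBall {R : ConformalRectangle} {κ r : ℝ} (hκ : 0 ≤ κ)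
    (hr : closure R.carrier ⊆ closedBall 0 r) : Freeze.enlarge R κ ⊆ closedBall 0 (r + κ) := by
  have hcol : ∀ i : Fin 4, Freeze.sideCollar R i κ ⊆ closedBall 0 (r + κ) := fun i p hp => by
    obtain ⟨a, ha, hd⟩ := (R.isCompact_arc i).exists_infDist_eq_dist ⟨_, R.pt_mem_arc_self i⟩ p
    have ha' := mem_closedBall_zero_iff.1 (hr (frontier_subset_closure (R.arc_subset_frontier i ha)))
    rw [mem_closedBall_zero_iff]
    linarith [hd ▸ hp.1, norm_le_norm_add_norm_sub' p a, dist_eq_norm p a, norm_sub_rev p a]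
  rintro p ((h | h) | h)
  · exact closedBall_subset_closedBall (by linarith) (hr (subset_closure h))
  · exact hcol 0 h
  · exact hcol 2 h

/-! ### The outer bracket: the crude bond event of `R'` is below the fattened event of `R` -/

/-- OUTER INCLUSION.  If the closed carrier of `R'` lies in the chart box `|re| ≤ 1+s, |im| ≤ 1` (U1), its arcs `0`/`2`
in the bottom/top `3s`-strips (U2), and `F` maps chart distances `< 8s` on `closedBall 0 4` to distances `< ε₀ ≤ ρ/2`,
then for `2d ≤ ρ/2` the crude bond crossing event of `R'` at mesh `d` lies in `Freeze.upperCrossing R ρ d` (clamp the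
chart abscissa to `[-1,1]`: window and targets are within `ρ` of `Ω`, `R.arc 0`, `R.arc 2`). [cite: SchrammSmirnov2011, Lemma 5.1] -/
theorem outer_subset_upperCrossing {R R' : ConformalRectangle} {F : ℂ ≃ₜ ℂ} (hF : IsSquareModel R F)
    {s ρ ε₀ d : ℝ} (hs : 0 < s) (hs4 : s ≤ 1 / 4) (hε₀ : ε₀ ≤ ρ / 2)
    (hη : ∀ q q' : ℂ, ‖q‖ ≤ 4 → ‖q'‖ ≤ 4 → dist q q' < 8 * s → dist (F q) (F q') < ε₀)
    (hU1 : closure R'.carrier ⊆ F.symm ⁻¹' {p : ℂ | -1 - s ≤ p.re ∧ p.re ≤ 1 + s ∧ -1 ≤ p.im ∧ p.im ≤ 1})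
    (hU2a : R'.arc 0 ⊆ F.symm ⁻¹' {p : ℂ | -1 - s ≤ p.re ∧ p.re ≤ 1 + s ∧ -1 ≤ p.im ∧ p.im ≤ -1 + 3 * s})
    (hU2b : R'.arc 2 ⊆ F.symm ⁻¹' {p : ℂ | -1 - s ≤ p.re ∧ p.re ≤ 1 + s ∧ 1 - 3 * s ≤ p.im ∧ p.im ≤ 1})
    (hd : 0 ≤ d) (hdρ : 2 * d ≤ ρ / 2) :
    embDomainCrossing squareLatticeEmbedding.z R'.carrier d (R'.arc 0) (R'.arc 2) ⊆ Freeze.upperCrossing R ρ d := by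
  -- a point whose chart is `s`-close laterally and `3s`-close vertically to the chart point `(clamp re, y₀)`
  have hclose : ∀ (b : ℂ) (y₀ : ℝ), |y₀| ≤ 1 → -1 - s ≤ (F.symm b).re → (F.symm b).re ≤ 1 + s →
      |(F.symm b).im| ≤ 3 / 2 → |(F.symm b).im - y₀| ≤ 3 * s →
      |(⟨max (-1) (min 1 (F.symm b).re), y₀⟩ : ℂ).re| ≤ 1 ∧ dist b (F ⟨max (-1) (min 1 (F.symm b).re), y₀⟩) < ε₀ := by
    intro b y₀ hy h1 h2 h3 h4
    obtain ⟨hc1, hc2⟩ := clamp_spec hs.le h1 h2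
    have key := hη (F.symm b) ⟨_, y₀⟩ (norm_le_four (abs_le.2 ⟨by linarith, by linarith⟩) (by linarith))
      (norm_le_four (hc2.trans (by norm_num)) (hy.trans (by norm_num))) ((dist_mk_le hc1 h4).trans_lt (by linarith))
    exact ⟨hc2, by rwa [F.apply_symm_apply] at key⟩
  have htgt : ∀ (k : Fin 4) (y₀ : ℝ) (A : Set ℂ), |y₀| = 1 → IsCompact A → A.Nonempty →
      (∀ q : ℂ, |q.re| ≤ 1 → q.im = y₀ → F q ∈ R.arc k) → (∀ b ∈ A, -1 - s ≤ (F.symm b).re ∧ (F.symm b).re ≤ 1 + s ∧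
        |(F.symm b).im| ≤ 3 / 2 ∧ |(F.symm b).im - y₀| ≤ 3 * s) → ∀ p : ℂ, infDist p A ≤ 2 * d → infDist p (R.arc k) ≤ ρ := by
    intro k y₀ A hy hA hAne hk hAbox p hp
    obtain ⟨b, hb, hbd⟩ := hA.exists_infDist_eq_dist hAne p
    obtain ⟨h1, h2, h3, h4⟩ := hAbox b hb
    obtain ⟨hc, hdist⟩ := hclose b y₀ hy.le h1 h2 h3 h4
    calc infDist p (R.arc k) ≤ dist p (F ⟨_, y₀⟩) := infDist_le_dist_of_mem (hk _ hc rfl)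
      _ ≤ dist p b + dist b (F ⟨_, y₀⟩) := dist_triangle _ _ _
      _ ≤ ρ := by rw [← hbd]; linarith [hdist.le]
  rintro ω ⟨x, hx, y, hy, hr⟩
  refine ⟨x, htgt 0 (-1) (R'.arc 0) (by norm_num) (R'.isCompact_arc 0) ⟨_, R'.pt_mem_arc_self 0⟩
      (fun q hq hqi => (chart_mem_arc_im hF hq).1 hqi) (fun b hb => ?_) _ hx,
    y, htgt 2 1 (R'.arc 2) (by norm_num) (R'.isCompact_arc 2) ⟨_, R'.pt_mem_arc_self 2⟩
      (fun q hq hqi => (chart_mem_arc_im hF hq).2 hqi) (fun b hb => ?_) _ hy, Freeze.openConnIn_mono (fun v hv => ?_) x y hr⟩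
  · obtain ⟨h1, h2, h3, h4⟩ := hU2a hb
    exact ⟨h1, h2, abs_le.2 ⟨by linarith, by linarith⟩, abs_le.2 ⟨by linarith, by linarith⟩⟩
  · obtain ⟨h1, h2, h3, h4⟩ := hU2b hb
    exact ⟨h1, h2, abs_le.2 ⟨by linarith, by linarith⟩, abs_le.2 ⟨by linarith, by linarith⟩⟩
  · simp only [mem_setOf_eq] at hv ⊢
    obtain ⟨h1, h2, h3, h4⟩ := hU1 (subset_closure hv)
    have him : |(F.symm ((d : ℂ) * squareLatticeEmbedding.z v)).im| ≤ 1 := abs_le.2 ⟨h3, h4⟩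
    obtain ⟨hc, hdist⟩ := hclose _ _ him h1 h2 (him.trans (by norm_num)) (by rw [sub_self, abs_zero]; positivity)
    rw [← infDist_closure]
    exact (infDist_le_dist_of_mem (chart_mem_closure hF hc him)).trans (by linarith [hdist.le])

/-! ### The inner bracket: the thinned event of `R` is below the crude bond event of `R''` -/

/-- INNER INCLUSION.  For a lattice configuration in `Freeze.lowerCrossing R κ ρ d` (an open path with `ρ`-balls in
`Ω ∪ collar₀ ∪ collar₂` from deep in `collar₀ ∖ Ω` to deep in `collar₂ ∖ Ω`), run extraction (`Freeze.exists_run`) with the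
sides "drawn in `collarᵢ`, outside `Ω` and outside `Ω''`" (`i = 0, 2`; the end vertices are such by (N1), (N4)) yields a run
drawn in `Ω''` (vertices in `Ω` are `ρ`-far from `R.arc 1 ∪ R.arc 3`, hence in the box (L)); the entering edge starts at a
collar-`0` vertex of `Ω'' ∖ Ω` of chart height in `[-1-2s, -1]` ((N1), (N4), `2κ`-far from `R.arc 2`), so it meets
`frontier Ω''` at height `≤ -1 + s/64`, `2s`-far from the unit corners: on `R''.arc 0` by (N3). [cite: SchrammSmirnov2011, Lemma 5.1] -/
theorem lowerCrossing_subset_inner {R R'' : ConformalRectangle} {F : ℂ ≃ₜ ℂ} (hF : IsSquareModel R F)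
    {s κ ρ ε₀ τ r d : ℝ} (hs : 0 < s) (hs4 : s ≤ 1 / 4) (hκ : 0 < κ) (hρ : 0 < ρ) (hε₀ρ : ε₀ ≤ ρ / 2) (hε₀κ : ε₀ ≤ κ)
    (hη : ∀ q q' : ℂ, ‖q‖ ≤ 4 → ‖q'‖ ≤ 4 → dist q q' < 8 * s → dist (F q) (F q') < ε₀)
    (hr : closure R.carrier ⊆ closedBall 0 r)
    (hτ : ∀ p p' : ℂ, ‖p‖ ≤ r + κ + 1 → ‖p'‖ ≤ r + κ + 1 → dist p p' < τ → dist (F.symm p) (F.symm p') < s / 64)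
    (hN1 : R''.carrier ⊆ R.carrier ∪ F '' {p : ℂ | |p.re| < 1 - s ∧ 1 ≤ |p.im|})
    (hL : F '' {p : ℂ | |p.re| < 1 - 2 * s ∧ |p.im| < 1 + s} ⊆ R''.carrier)
    (hN3a : frontier R''.carrier ∩ F '' {p : ℂ | p.im ≤ -1 + s / 32 ∧ 2 * s ≤ dist p (1 - Complex.I) ∧
      2 * s ≤ dist p (-1 - Complex.I)} ⊆ R''.arc 0)
    (hN3b : frontier R''.carrier ∩ F '' {p : ℂ | 1 - s / 32 ≤ p.im ∧ 2 * s ≤ dist p (1 + Complex.I) ∧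
      2 * s ≤ dist p (-1 + Complex.I)} ⊆ R''.arc 2)
    (hN4 : R''.carrier ⊆ F '' {p : ℂ | |p.im| < 1 + 2 * s})
    (hd : 0 < d) (hdτ : 2 * d < τ) (hdρ : 2 * d ≤ ρ / 2) (hdκ : 2 * d ≤ κ) (hd1 : 2 * d ≤ 1)
    {ω : BondConfig (Site 2)} (hω : ω ⊆ (zdGraph 2).edgeSet) (h : ω ∈ Freeze.lowerCrossing R κ ρ d) :
    ω ∈ embDomainCrossing squareLatticeEmbedding.z R''.carrier d (R''.arc 0) (R''.arc 2) := by
  obtain ⟨u, hu, v, hv, huv⟩ := h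
  rw [mem_openConnIn_iff_exists_openWalk] at huv
  obtain ⟨p, hp⟩ := huv
  set P : Site 2 → ℂ := fun x => (d : ℂ) * squareLatticeEmbedding.z x with hP
  have hcen : ∀ x : Site 2, P x ∈ closedBall (P x) ρ := fun x => mem_closedBall_self hρ.le
  have hstep : ∀ x y, (openGraph ω).Adj x y → dist (P x) (P y) ≤ 2 * d := fun x y hxy => by
    have hadj : (zdGraph 2).Adj x y := by simpa [SimpleGraph.mem_edgeSet] using hω ((openGraph_adj ω x y).1 hxy).1
    rw [show dist (P x) (P y) = |d| * Real.sqrt 2 from Freeze.dist_z_eq_of_adj hadj d, abs_of_pos hd]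
    nlinarith [(Real.sqrt_le_left zero_le_two).2 (show (2 : ℝ) ≤ 2 ^ 2 by norm_num)]
  have hnorm : ∀ x, closedBall (P x) ρ ⊆ Freeze.enlarge R κ → ∀ w, dist (P x) w ≤ 2 * d →
      ‖P x‖ ≤ r + κ + 1 ∧ ‖w‖ ≤ r + κ + 1 := fun x hx w hw => by
    have h1 := mem_closedBall_zero_iff.1 (enlarge_subset_closedBall hκ.le hr (hx (hcen x)))
    have h2 : ‖w‖ ≤ ‖P x‖ + dist w (P x) := dist_eq_norm w (P x) ▸ norm_le_insert' w (P x)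
    exact ⟨by linarith, by rw [dist_comm] at h2; linarith⟩
  -- (G1) good vertices are `ρ`-far from `R.arc 1 ∪ R.arc 3`; (G2) if drawn in `Ω` their chart abscissa is `< 1 - 4s`
  have hfar : ∀ x, closedBall (P x) ρ ⊆ Freeze.enlarge R κ → ∀ a ∈ R.arc 1 ∪ R.arc 3, ρ < dist (P x) a :=
    fun x hx a ha => not_le.1 fun hle => not_mem_enlarge_of_mem_arc hκ ha (hx (mem_closedBall'.2 hle))
  have hG2 : ∀ x, closedBall (P x) ρ ⊆ Freeze.enlarge R κ → P x ∈ R.carrier → |(F.symm (P x)).re| < 1 - 4 * s := by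
    intro x hx hxΩ
    obtain ⟨hre, him⟩ := (chart_mem_carrier_iff hF).1 hxΩ
    by_contra hge
    push Not at hge
    obtain ⟨σ, hσ1, hσq⟩ : ∃ σ : ℝ, |σ| = 1 ∧ |(F.symm (P x)).re - σ| ≤ 4 * s := by
      rcases le_or_gt 0 (F.symm (P x)).re with h0 | h0
      · rw [abs_of_nonneg h0] at hre hge; exact ⟨1, abs_one, abs_le.2 ⟨by linarith, by linarith⟩⟩
      · rw [abs_of_neg h0] at hre hge; exact ⟨-1, by simp, abs_le.2 ⟨by linarith, by linarith⟩⟩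
    have harc := chart_mem_arc_re hF (q := ⟨σ, (F.symm (P x)).im⟩) hσ1 him.le
    have hlt := hη (F.symm (P x)) ⟨σ, (F.symm (P x)).im⟩ (norm_le_four (by linarith) (by linarith))
      (norm_le_four (show |σ| ≤ 2 by linarith) (show |(F.symm (P x)).im| ≤ 2 by linarith))
      ((dist_mk_le hσq (show |(F.symm (P x)).im - (F.symm (P x)).im| ≤ 0 by simp)).trans_lt (by linarith))
    rw [F.apply_symm_apply] at hlt
    linarith [hfar x hx _ harc]
  -- the two sides of the run extraction: drawn in `collarᵢ`, outside `Ω`, outside `Ω''`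
  set inS : Fin 4 → Site 2 → Prop := fun i y => P y ∈ Freeze.sideCollar R i κ ∧ P y ∉ R.carrier ∧ P y ∉ R''.carrier
  have hsep : ∀ x y, inS 0 x → inS 2 y → ¬ (openGraph ω).Adj x y := fun x y hx hy hxy => by
    linarith [hstep x y hxy, Freeze.lt_dist_of_mem_sideCollar (by decide : (0 : Fin 4) ≠ 2) hx.1 hy.1]
  -- the end vertices are such ((N1), (N4): else `Ω` would come within `ρ` of them)
  have hends : ∀ (i : Fin 4) (x : Site 2), closedBall (P x) ρ ⊆ Freeze.sideCollar R i κ \ R.carrier → inS i x := by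
    refine fun i x hx => ⟨(hx (hcen x)).1, (hx (hcen x)).2, fun hx'' => ?_⟩
    rcases hN1 hx'' with hΩ | hq
    · exact (hx (hcen x)).2 hΩ
    obtain ⟨hre, him⟩ := symm_mem_of_mem_image hq
    have him' : |(F.symm (P x)).im| < 1 + 2 * s := symm_mem_of_mem_image (hN4 hx'')
    obtain ⟨t, ht1, htq⟩ : ∃ t : ℝ, |t| < 1 ∧ |(F.symm (P x)).im - t| ≤ 3 * s := by
      rcases le_or_gt 0 (F.symm (P x)).im with h0 | h0
      · rw [abs_of_nonneg h0] at him him'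
        exact ⟨1 - s, abs_lt.2 ⟨by linarith, by linarith⟩, abs_le.2 ⟨by linarith, by linarith⟩⟩
      · rw [abs_of_neg h0] at him him'
        exact ⟨-(1 - s), abs_lt.2 ⟨by linarith, by linarith⟩, abs_le.2 ⟨by linarith, by linarith⟩⟩
    have hin : F ⟨(F.symm (P x)).re, t⟩ ∈ R.carrier :=
      (chart_mem_carrier_iff hF).2 (by rw [F.symm_apply_apply]; exact ⟨by show |_| < 1; linarith, ht1⟩)
    have hlt := hη (F.symm (P x)) ⟨(F.symm (P x)).re, t⟩ (norm_le_four (by linarith) (by linarith))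
      (norm_le_four (show |(F.symm (P x)).re| ≤ 2 by linarith) (show |t| ≤ 2 by linarith))
      ((dist_mk_le (show |(F.symm (P x)).re - (F.symm (P x)).re| ≤ 0 by simp) htq).trans_lt (by linarith))
    rw [F.apply_symm_apply] at hlt
    exact (hx (mem_closedBall'.2 (by linarith : dist (P x) (F ⟨(F.symm (P x)).re, t⟩) ≤ ρ))).2 hin
  obtain ⟨c', c, e, e', q, hc', hcc, he', hee, hq⟩ := Freeze.exists_run (inS 0) (inS 2)
    (fun y => closedBall (P y) ρ ⊆ Freeze.enlarge R κ) hsep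
    (fun x hx hx' => Freeze.not_mem_sideCollar_of_mem (by decide : (0 : Fin 4) ≠ 2) hx.1 hx'.1) p (hends 0 u hu) (hends 2 v hv) hp
  -- the run is drawn in `Ω''` ((G2) and clause (L) for the vertices drawn in `Ω`)
  have hin : ∀ y ∈ q.support, P y ∈ R''.carrier := fun y hy => by
    obtain ⟨hg, h0, h2⟩ := hq y hy
    by_contra hc
    have hΩ : P y ∉ R.carrier := fun h => hc (hL ⟨F.symm (P y),
      ⟨by linarith [hG2 y hg h], by linarith [((chart_mem_carrier_iff hF).1 h).2]⟩, F.apply_symm_apply _⟩)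
    rcases hg (hcen y) with (h | h) | h
    exacts [hΩ h, h0 ⟨h, hΩ, hc⟩, h2 ⟨h, hΩ, hc⟩]
  -- KEY: the entering / leaving edge `x' — x` meets `frontier Ω''` on `R''.arc i` (`H` = signed chart height)
  have key : ∀ (i : Fin 4) (H : ℂ → ℝ) (k₁ k₂ : ℂ), (∀ z z' : ℂ, H z - H z' ≤ dist z z') →
      ‖k₁‖ ≤ 4 → ‖k₂‖ ≤ 4 → F k₁ ∈ R.arc 1 ∪ R.arc 3 → F k₂ ∈ R.arc 1 ∪ R.arc 3 →
      (∀ w ∈ frontier R''.carrier, 1 - s / 32 ≤ H (F.symm w) → 2 * s ≤ dist (F.symm w) k₁ →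
        2 * s ≤ dist (F.symm w) k₂ → w ∈ R''.arc i) →
      (∀ z : ℂ, z ∈ Freeze.sideCollar R i κ → z ∉ R.carrier → z ∈ R''.carrier →
        1 ≤ H (F.symm z) ∧ |(F.symm z).re| ≤ 1 ∧ |(F.symm z).im| ≤ 3 / 2) →
      ∀ x' x : Site 2, inS i x' → P x ∈ R''.carrier → closedBall (P x) ρ ⊆ Freeze.enlarge R κ →
        (openGraph ω).Adj x' x → infDist (P x) (R''.arc i) ≤ 2 * d := by
    intro i H k₁ k₂ hH hk₁ hk₂ hk₁a hk₂a hN3 hV x' x hx' hx hg hadj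
    have hdd : dist (P x) (P x') ≤ 2 * d := by rw [dist_comm]; exact hstep _ _ hadj
    obtain ⟨hnx, hnx'⟩ := hnorm x hg (P x') hdd
    -- `x` is not drawn in `Ω` (else `x'` would be drawn in the box of clause (L))
    have hxΩ : P x ∉ R.carrier := fun hxΩ => by
      have h4 := hG2 x hg hxΩ
      obtain ⟨-, him⟩ := (chart_mem_carrier_iff hF).1 hxΩ
      have hch := hτ _ _ hnx hnx' (lt_of_le_of_lt hdd hdτ)
      have hre := abs_sub_abs_le_abs_sub (F.symm (P x')).re (F.symm (P x)).re
      have him' := abs_sub_abs_le_abs_sub (F.symm (P x')).im (F.symm (P x)).im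
      refine hx'.2.2 (hL ⟨F.symm (P x'), ⟨?_, ?_⟩, F.apply_symm_apply _⟩)
      · linarith [abs_sub_comm (F.symm (P x')).re (F.symm (P x)).re, abs_re_sub_lt hch]
      · linarith [abs_sub_comm (F.symm (P x')).im (F.symm (P x)).im, abs_im_sub_lt hch]
    have hxi : P x ∈ Freeze.sideCollar R i κ := by
      have aux : ∀ j : Fin 4, P x ∈ Freeze.sideCollar R j κ → P x ∈ Freeze.sideCollar R i κ := fun j hj => by
        by_cases hji : j = i
        · exact hji ▸ hj
        · linarith [Freeze.lt_dist_of_mem_sideCollar (Ne.symm hji) hx'.1 hj, hstep _ _ hadj]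
      rcases hg (hcen x) with (h | h) | h
      exacts [(hxΩ h).elim, aux 0 h, aux 2 h]
    obtain ⟨hHx, hrex, himx⟩ := hV (P x) hxi hxΩ hx
    obtain ⟨w, hw, hwf⟩ := exists_mem_segment_frontier R''.isOpen hx fun h' => hx'.2.2 (h' (right_mem_segment _ _ _))
    have hxw : dist (P x) w ≤ 2 * d := (mem_closedBall'.1 (segment_subset_closedBall_left (P x) (P x') hw)).trans hdd
    have hch := hτ _ _ hnx (hnorm x hg w hxw).2 (lt_of_le_of_lt hxw hdτ)
    have hre := abs_re_sub_lt hch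
    have him := abs_im_sub_lt hch
    have hw4 : ‖F.symm w‖ ≤ 4 := by
      refine norm_le_four ?_ ?_
      · linarith [abs_sub_abs_le_abs_sub (F.symm w).re (F.symm (P x)).re, abs_sub_comm (F.symm w).re (F.symm (P x)).re]
      · linarith [abs_sub_abs_le_abs_sub (F.symm w).im (F.symm (P x)).im, abs_sub_comm (F.symm w).im (F.symm (P x)).im]
    have hcorner : ∀ k : ℂ, ‖k‖ ≤ 4 → F k ∈ R.arc 1 ∪ R.arc 3 → 2 * s ≤ dist (F.symm w) k := fun k hk hka => by
      by_contra hlt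
      have h1 := hη (F.symm w) k hw4 hk (by linarith [not_le.1 hlt])
      rw [F.apply_symm_apply] at h1
      linarith [dist_triangle (P x) w (F k), hfar x hg _ hka]
    exact (infDist_le_dist_of_mem (hN3 w hwf (by linarith [hH (F.symm (P x)) (F.symm w)]) (hcorner k₁ hk₁ hk₁a)
      (hcorner k₂ hk₂ hk₂a))).trans hxw
  -- the signed heights of collar vertices of `Ω'' ∖ Ω`: (N1), (N4), and `2κ`-far from the opposite arc `R.arc j` of `R`
  have hV : ∀ (i j : Fin 4) (σ : ℝ), j ≠ i → (σ = 1 ∨ σ = -1) → (∀ q : ℂ, |q.re| ≤ 1 → q.im = σ → F q ∈ R.arc j) →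
      ∀ z : ℂ, z ∈ Freeze.sideCollar R i κ → z ∉ R.carrier → z ∈ R''.carrier →
        1 ≤ -σ * (F.symm z).im ∧ |(F.symm z).re| ≤ 1 ∧ |(F.symm z).im| ≤ 3 / 2 := by
    intro i j σ hji hσ hside z hzi hzΩ hz
    rcases hN1 hz with h | h
    · exact (hzΩ h).elim
    obtain ⟨hre, him⟩ := symm_mem_of_mem_image h
    have him' : |(F.symm z).im| < 1 + 2 * s := symm_mem_of_mem_image (hN4 hz)
    refine ⟨not_lt.1 fun hlt => ?_, by linarith, by linarith⟩
    have hdq : |(F.symm z).im - σ| < 2 * s := by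
      obtain ⟨h1, h2⟩ := abs_lt.1 him'
      rcases hσ with rfl | rfl
      · rcases le_abs'.1 him with h3 | h3
        exacts [by linarith, abs_lt.2 ⟨by linarith, by linarith⟩]
      · rcases le_abs'.1 him with h3 | h3
        exacts [abs_lt.2 ⟨by linarith, by linarith⟩, by linarith]
    have hlt' := hη (F.symm z) ⟨(F.symm z).re, σ⟩ (norm_le_four (by linarith) (by linarith))
      (norm_le_four (show |(F.symm z).re| ≤ 2 by linarith) (by rcases hσ with rfl | rfl <;> norm_num))
      ((dist_mk_le (show |(F.symm z).re - (F.symm z).re| ≤ 0 by simp) hdq.le).trans_lt (by linarith))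
    rw [F.apply_symm_apply] at hlt'
    have harc : F ⟨(F.symm z).re, σ⟩ ∈ R.arc j := hside _ (by show |(F.symm z).re| ≤ 1; linarith) rfl
    linarith [hzi.2, (Freeze.infDist_otherArcs_le (R := R) hji z).trans (infDist_le_dist_of_mem harc)]
  have himH : ∀ z z' : ℂ, z.im - z'.im ≤ dist z z' := fun z z' =>
    (le_abs_self _).trans (by rw [← Complex.sub_im, dist_eq_norm]; exact Complex.abs_im_le_norm _)
  refine ⟨c, ?_, e, ?_, by rw [mem_openConnIn_iff_exists_openWalk]; exact ⟨q, hin⟩⟩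
  · refine key 0 (fun z => -z.im) (1 - Complex.I) (-1 - Complex.I)
      (fun z z' => by show -z.im - -z'.im ≤ dist z z'; rw [dist_comm]; linarith [himH z' z])
      (norm_le_four (by norm_num) (by norm_num)) (norm_le_four (by norm_num) (by norm_num))
      (chart_mem_arc_re hF (by norm_num) (by norm_num)) (chart_mem_arc_re hF (by norm_num) (by norm_num))
      (fun w hw h1 h2 h3 => hN3a ⟨hw, F.symm w, ⟨by linarith, h2, h3⟩, F.apply_symm_apply w⟩)
      (fun z h1 h2 h3 => ?_) c' c hc' (hin c q.start_mem_support) (hq c q.start_mem_support).1 hcc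
    simpa using hV 0 2 1 (by decide) (Or.inl rfl) (fun q hq hqi => (chart_mem_arc_im hF hq).2 hqi) z h1 h2 h3
  · refine key 2 (fun z => z.im) (1 + Complex.I) (-1 + Complex.I) himH (norm_le_four (by norm_num) (by norm_num)) (norm_le_four (by norm_num) (by norm_num))
      (chart_mem_arc_re hF (by norm_num) (by norm_num)) (chart_mem_arc_re hF (by norm_num) (by norm_num))
      (fun w hw h1 h2 h3 => hN3b ⟨hw, F.symm w, ⟨h1, h2, h3⟩, F.apply_symm_apply w⟩)
      (fun z h1 h2 h3 => ?_) e' e he' (hin e q.end_mem_support) (hq e q.end_mem_support).1 hee.symm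
    simpa using hV 2 0 (-1) (by decide) (Or.inr rfl) (fun q hq hqi => (chart_mem_arc_im hF hq).1 hqi) z h1 h2 h3

/-! ### The stub -/

/-- **Stub T3 — the bracket gap at `q = 0`** (registered signature `Sig.stub_bracketGapZero` of the skeleton v6,
verbatim).  For every conformal rectangle `R` with square model `F` and every `e > 0` there is a scale `s ∈ (0, 1/4]`
such that for ALL outer brackets `R'` (clauses (W1)–(W3), (U1), (U2)) and inner brackets `R''` (clauses (N1)–(N4), (L)) at
scale `s`, eventually as the Union-Jack mesh `δ → 0⁺`, `P_{1/2,0}[cross_δ R'] − P_{1/2,0}[cross_δ R''] ≤ e`: at bond mesh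
`d`, `bondProb R' d ≤ Pb[upper] ≤ Pb[lower] + e/3 ≤ bondProb R'' d + e/3` (the two inclusions, lattice configurations
a.s.), then Kesten's covering `wide_tendsto_sub` (twice `e/3`) and the change of mesh `δ = √2 d`. [cite: SchrammSmirnov2011, Lemma 5.1] -/
theorem stub_bracketGapZero :
    ∀ (R : Literature.Probability.RandomPlanarGeometry.ConformalRectangle) (F : ℂ ≃ₜ ℂ), Literature.Probability.Percolation.IsSquareModel R F →
      ∀ e : ℝ, 0 < e → ∃ s : ℝ, 0 < s ∧ s ≤ 1 / 4 ∧
        ∀ R' R'' : Literature.Probability.RandomPlanarGeometry.ConformalRectangle,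
          (F '' {p : ℂ | |p.re| < 1 ∧ |p.im| < 1 - s} ⊆ R'.carrier ∧
            Disjoint (R.arc 0 ∪ R.arc 2) (closure R'.carrier) ∧
            frontier R'.carrier ∩ F '' {p : ℂ | -1 - s ≤ p.re ∧ p.re ≤ 1 + s ∧ -1 - s ≤ p.im ∧ p.im ≤ -1 + 3 * s / 2} ⊆ R'.arc 0 ∧
            frontier R'.carrier ∩ F '' {p : ℂ | -1 - s ≤ p.re ∧ p.re ≤ 1 + s ∧ 1 - 3 * s / 2 ≤ p.im ∧ p.im ≤ 1 + s} ⊆ R'.arc 2 ∧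
            closure R'.carrier ⊆ F '' {p : ℂ | -1 - s ≤ p.re ∧ p.re ≤ 1 + s ∧ -1 ≤ p.im ∧ p.im ≤ 1} ∧
            R'.arc 0 ⊆ F '' {p : ℂ | -1 - s ≤ p.re ∧ p.re ≤ 1 + s ∧ -1 ≤ p.im ∧ p.im ≤ -1 + 3 * s} ∧
            R'.arc 2 ⊆ F '' {p : ℂ | -1 - s ≤ p.re ∧ p.re ≤ 1 + s ∧ 1 - 3 * s ≤ p.im ∧ p.im ≤ 1}) →
          (R''.carrier ⊆ R.carrier ∪ F '' {p : ℂ | |p.re| < 1 - s ∧ 1 ≤ |p.im|} ∧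
            R''.arc 0 ⊆ F '' {p : ℂ | |p.re| < 1 - s ∧ p.im < -1 - s / 32} ∧
            R''.arc 2 ⊆ F '' {p : ℂ | |p.re| < 1 - s ∧ 1 + s / 32 < p.im} ∧
            F '' {p : ℂ | |p.re| < 1 - 2 * s ∧ |p.im| < 1 + s} ⊆ R''.carrier ∧
            frontier R''.carrier ∩ F '' {p : ℂ | p.im ≤ -1 + s / 32 ∧ 2 * s ≤ dist p (1 - Complex.I) ∧ 2 * s ≤ dist p (-1 - Complex.I)} ⊆ R''.arc 0 ∧
            frontier R''.carrier ∩ F '' {p : ℂ | 1 - s / 32 ≤ p.im ∧ 2 * s ≤ dist p (1 + Complex.I) ∧ 2 * s ≤ dist p (-1 + Complex.I)} ⊆ R''.arc 2 ∧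
            R''.carrier ⊆ F '' {p : ℂ | |p.im| < 1 + 2 * s}) →
          ∀ᶠ δ : ℝ in nhdsWithin 0 (Set.Ioi 0),
            (prodBernoulli (mixedParam 0)).real
                (siteEmbDomainCrossing unionJackGraph unionJackEmbed R'.carrier δ (R'.arc 0) (R'.arc 2)) -
              (prodBernoulli (mixedParam 0)).real
                (siteEmbDomainCrossing unionJackGraph unionJackEmbed R''.carrier δ (R''.arc 0) (R''.arc 2)) ≤ e := by
  intro R F hF e he
  obtain ⟨κ, hκ, ρ, hρ, hC⟩ :=
    stub_CrudeCrossingContinuity_of_SS QuadCrossing.SchrammSmirnov2011_lemma_5_1_holds R (e / 3) (by positivity)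
  have hε₀ : 0 < min (ρ / 2) κ := lt_min (half_pos hρ) hκ
  obtain ⟨η, hη, hηF⟩ := exists_modulus_closedBall F 4 hε₀
  set s : ℝ := min (1 / 4) (η / 8)
  have hs : 0 < s := lt_min (by norm_num) (by positivity)
  have hs4 : s ≤ 1 / 4 := min_le_left _ _
  have hs8 : 8 * s ≤ η := by linarith [min_le_right (1 / 4 : ℝ) (η / 8)]
  have hηs : ∀ q q' : ℂ, ‖q‖ ≤ 4 → ‖q'‖ ≤ 4 → dist q q' < 8 * s → dist (F q) (F q') < min (ρ / 2) κ :=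
    fun q q' hq hq' hqq => hηF q q' hq hq' (hqq.trans_le hs8)
  refine ⟨s, hs, hs4, ?_⟩
  rintro R' R'' ⟨-, -, -, -, hU1, hU2a, hU2b⟩ ⟨hN1, -, -, hL, hN3a, hN3b, hN4⟩
  rw [Homeomorph.image_eq_preimage_symm] at hU1 hU2a hU2b
  obtain ⟨r, hr⟩ := R.isBounded.closure.subset_closedBall 0
  obtain ⟨τ, hτ, hτF⟩ := exists_modulus_closedBall F.symm (r + κ + 1) (by positivity : (0 : ℝ) < s / 64)
  have hbond : ∀ᶠ d in 𝓝[>] (0 : ℝ), bondProb R' d - bondProb R'' d ≤ e / 3 := by -- the BOND-side gap at bond mesh `d`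
    filter_upwards [hC, Ioo_mem_nhdsGT (half_pos hτ), Ioo_mem_nhdsGT (by positivity : (0 : ℝ) < ρ / 4),
      Ioo_mem_nhdsGT (half_pos hκ), Ioo_mem_nhdsGT (one_half_pos (α := ℝ))] with d hCd hτ' hρ' hκ' h1'
    have hd : 0 < d := hτ'.1
    have h1 : bondProb R' d ≤ (bondPercolation (zdGraph 2) half).real (Freeze.upperCrossing R ρ d) :=
      measureReal_mono (outer_subset_upperCrossing hF hs hs4 (min_le_left _ _) hηs hU1 hU2a hU2b hd.le (by linarith [hρ'.2]))
    have h2 : (bondPercolation (zdGraph 2) half).real (Freeze.lowerCrossing R κ ρ d) ≤ bondProb R'' d := by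
      refine ENNReal.toReal_mono (measure_ne_top _ _) (measure_mono_ae ?_)
      filter_upwards [ae_subset_edgeSet (zdGraph 2) half] with ω hω hlow
      exact lowerCrossing_subset_inner hF hs hs4 hκ hρ (min_le_left _ _) (min_le_right _ _) hηs hr hτF hN1 hL
        hN3a hN3b hN4 hd (by linarith [hτ'.2]) (by linarith [hρ'.2]) (by linarith [hκ'.2]) (by linarith [h1'.2]) hω hlow
    linarith
  have h1 := Metric.tendsto_nhds.1 (wide_tendsto_sub R') (e / 3) (by positivity) -- Kesten's covering, then `δ = √2 d`
  have h2 := Metric.tendsto_nhds.1 (wide_tendsto_sub R'') (e / 3) (by positivity)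
  have hev : ∀ᶠ d in 𝓝[>] (0 : ℝ), ujCrossingProb 0 R' (Real.sqrt 2 * d) - ujCrossingProb 0 R'' (Real.sqrt 2 * d) ≤ e := by
    filter_upwards [hbond, h1, h2] with d hb h1 h2
    rw [Real.dist_0_eq_abs, abs_lt] at h1 h2
    linarith [h1.2, h2.1]
  show ∀ᶠ δ : ℝ in 𝓝[>] (0 : ℝ), ujCrossingProb 0 R' δ - ujCrossingProb 0 R'' δ ≤ e
  exact tendsto_principal.1 ((tendsto_comp_const_mul_iff (f := fun δ : ℝ => δ)
    (l := 𝓟 {δ : ℝ | ujCrossingProb 0 R' δ - ujCrossingProb 0 R'' δ ≤ e}) (Real.sqrt_pos.2 two_pos)).1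
    (tendsto_principal.2 hev))

end Summit.CriticalPhenomena.CardyFormulaZ2.Cruxes.MixedInterpolation.Registered

end
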